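import Summits.PneNP.PneNP.Theorems.ExpanderLinearGeneratorsLinearGeneratorModPFregeHardMod2Refute
import HarnessLib

/-!
# For `p = 2` the `AC⁰[p]` rung fails: polynomial-size depth-35 `textbookFrege(MOD₂)` refutations
of every unsolvable linear system over `𝔽₂` (calibration of `LinearGeneratorModPFregeHard`)

Support file for item `stmt-PneNP-11444` (`LinearGeneratorModPFregeHard`, the `AC⁰[p]`-Frege rung
of route `ExpanderLinearGenerators`).  The rung asks, for ODD primes `p`, for exponential lower
bounds on depth-`d` `textbookFrege(MOD_p)` proofs of `¬ ofCNF (sumEncoding 1 E)` for expanding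
unsolvable `𝔽₂`-systems `E`; its docstring asserts that the restriction `p ≠ 2` is essential:
"for `p = 2` … the statement is FALSE: `MOD₂` gates sum the certificate rows in polynomial size".
This file kernel-checks the positive half of that remark, uniformly and without any expansion or
sparsity hypothesis:

* `exists_modTwo_refutation` — **there are absolute constants `d₀ = 35` and `c` such that every
  unsolvable system `E : Fin m → LinEqMod 2 n` has a `textbookFrege(MOD₂)`-proof of
  `¬ ofCNF (sumEncoding 1 E)` of depth `≤ d₀` and size `≤ (|ofCNF (sumEncoding 1 E)| + m + n + 2)^c`**
  (polynomial in the size of the refuted formula and the dimensions).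

The proof is the summation argument made formal in `…Mod2*.lean`: a dual certificate (rows
summing to `0 = 1`), parity atoms `MOD_{2,c}(y₀,…,y_{k-1})` for the rows and their accumulated
symmetric differences, the `MOD₂` axioms of Buss et al. (Def. 1.1) unfolding one argument at a
time, each row's parity read off its canonical clauses, the parities XOR-ed along the certificate,
and the final empty parity `MOD_{2,1}(∅)` contradicting axiom 2; this file only converts the raw
budget of `exists_modTwo_refutation_raw` into the polynomial.  (The exponent `c = 12194` reflects
the generous constant `2^6002` tick budget allotted to the brute-force small-tautology steps, not
the construction, which is cubic.)

Sources: S. Buss, R. Impagliazzo, J. Krajíček, P. Pudlák, A. A. Razborov, J. Sgall, *Proof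
complexity in algebraic systems and bounded depth Frege systems with modular counting*, Comput.
Complexity 6 (1996/97), Def. 1.1; J. Krajíček, *Proof Complexity* (CUP 2019), §15.6 (the
`AC⁰[p]`-Frege problem concerns `MOD_p` gates against counting modulo a different prime; parity is
easy with `MOD₂` gates — folklore).
-/

set_option linter.dupNamespace false -- `Summit.PneNP.PneNP.…`: summit = sub-problem (D-0017)

namespace Summit.PneNP.PneNP.Theorems.ModTwo

open Literature.Computability.Complexity Literature.Computability.Complexity.PropForm
open Literature.Computability.MetaComplexity

/-! ### Powers of one parameter, with the target exponent as a linear side condition -/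

/-- Monotonicity of `X^·` for `X ≥ 2`. [folklore] -/
theorem xpow_mono {X i j : ℕ} (hX : 2 ≤ X) (h : i ≤ j) : X ^ i ≤ X ^ j :=
  Nat.pow_le_pow_right (by omega) h

/-- Products: `a ≤ X^i`, `b ≤ X^j`, `i + j ≤ k` give `ab ≤ X^k`. [folklore] -/
theorem xpow_mul {X a b i j k : ℕ} (hX : 2 ≤ X) (ha : a ≤ X ^ i) (hb : b ≤ X ^ j)
    (hk : i + j ≤ k) : a * b ≤ X ^ k :=
  (Nat.mul_le_mul ha hb).trans (by rw [← pow_add]; exact xpow_mono hX hk)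

/-- Sums: `a ≤ X^i`, `b ≤ X^j`, `i, j < k` give `a + b ≤ X^k`. [folklore] -/
theorem xpow_add {X a b i j k : ℕ} (hX : 2 ≤ X) (ha : a ≤ X ^ i) (hb : b ≤ X ^ j)
    (hi : i + 1 ≤ k) (hj : j + 1 ≤ k) : a + b ≤ X ^ k := by
  have h1 : a ≤ X ^ (k - 1) := ha.trans (xpow_mono hX (by omega))
  have h2 : b ≤ X ^ (k - 1) := hb.trans (xpow_mono hX (by omega))
  have hk : k - 1 + 1 = k := by omega
  calc a + b ≤ X ^ (k - 1) + X ^ (k - 1) := add_le_add h1 h2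
    _ = X ^ (k - 1) * 2 := by ring
    _ ≤ X ^ (k - 1) * X := Nat.mul_le_mul_left _ hX
    _ = X ^ k := by rw [← pow_succ, hk]

/-- Constants: `c ≤ 2^i` gives `c ≤ X^i`. [folklore] -/
theorem xpow_const {X c : ℕ} (i : ℕ) (hX : 2 ≤ X) (hc : c ≤ 2 ^ i) : c ≤ X ^ i :=
  hc.trans (Nat.pow_le_pow_left hX i)

/-! ### The polynomial bound -/

/-- **`MOD₂`-Frege refutes unsolvable `𝔽₂`-systems in polynomial size at depth `35`.** There are
constants `d₀, c` such that for every unsolvable `E : Fin m → LinEqMod 2 n` some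
`textbookFrege(MOD₂)`-proof `π` of `¬ ofCNF (sumEncoding 1 E)` has depth `≤ d₀` and
`modProofSize π ≤ (|ofCNF (sumEncoding 1 E)| + m + n + 2)^c`.  Hence the `p = 2` analogue of
`LinearGeneratorModPFregeHard` can only hold vacuously (no exponential lower bound survives), which
is why the rung is stated for odd primes. [Buss et al. 1997, Def. 1.1; Krajíček 2019, §15.6]
[folklore] -/
theorem exists_modTwo_refutation :
    ∃ d₀ c : ℕ, ∀ (n m : ℕ) (E : Fin m → LinEqMod 2 n), ¬ SystemSat E Finset.univ →
      ∃ π : List (PropFormMod 2 ℕ),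
        textbookFrege.IsModDepthProofOf d₀ π
          (PropFormMod.ofPropForm (neg (PropForm.ofCNF (sumEncoding 1 E)))) ∧
        modProofSize π ≤ ((PropForm.ofCNF (sumEncoding 1 E)).size + m + n + 2) ^ c := by
  refine ⟨35, 12194, fun n m E hE => ?_⟩
  obtain ⟨hl, t, W, M, π, hπ, hhl, hW, hM, ht, hsize⟩ := exists_modTwo_refutation_raw E hE
  refine ⟨π, hπ, hsize.trans ?_⟩
  -- the big constant and the tick budget become symbolic
  obtain ⟨A, hA⟩ : ∃ A : ℕ, A = 6002 := ⟨_, rfl⟩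
  generalize hL : (2 : ℕ) ^ 6002 = L at ht
  have hLA : L ≤ 2 ^ A := by rw [hA, ← hL]
  -- everything is a power of `X = |ofCNF φ| + m + n + 2 ≥ 2`
  generalize hS : (PropForm.ofCNF (sumEncoding 1 E)).size = S at hM ⊢
  have hMcS : (sumEncoding 1 E).length ≤ S := hS ▸ length_le_size_ofCNF _
  generalize hMc : (sumEncoding 1 E).length = Mc at hW ht hMcS ⊢
  generalize hX : S + m + n + 2 = X
  have hX2 : 2 ≤ X := by omega
  have e1 : 1 ≤ X ^ 0 := by simp
  have en : n ≤ X ^ 1 := by rw [pow_one]; omega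
  have em : m ≤ X ^ 1 := by rw [pow_one]; omega
  have eS : S ≤ X ^ 1 := by rw [pow_one]; omega
  have eMc : Mc ≤ X ^ 1 := by rw [pow_one]; omega
  have eL : L ≤ X ^ A := xpow_const A hX2 hLA
  have c3 : 3 ≤ X ^ 2 := xpow_const 2 hX2 (by norm_num)
  have c5 : 5 ≤ X ^ 3 := xpow_const 3 hX2 (by norm_num)
  -- small combinations
  have en1 : n + 1 ≤ X ^ 2 := xpow_add hX2 en e1 (by norm_num) (by norm_num)
  have e2n : 2 * n ≤ X ^ 2 := by rw [two_mul]; exact xpow_add hX2 en en (by norm_num) (by norm_num)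
  have e2n2 : 2 * n + 2 ≤ X ^ 3 := by
    rw [show 2 * n + 2 = (n + 1) + (n + 1) from by ring]
    exact xpow_add hX2 en1 en1 (by norm_num) (by norm_num)
  have e2m : 2 * m ≤ X ^ 2 := by rw [two_mul]; exact xpow_add hX2 em em (by norm_num) (by norm_num)
  have e2m1 : 2 * m + 1 ≤ X ^ 3 := xpow_add hX2 e2m e1 (by norm_num) (by norm_num)
  have ehl : hl ≤ X ^ 6 := hhl.trans (xpow_mul hX2 e2m1 e2n2 (by norm_num))
  have eL3 : L + 3 ≤ X ^ (A + 1) := xpow_add hX2 eL c3 (by omega) (by omega)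
  have eL2 : L + 2 ≤ X ^ (A + 1) := (Nat.add_le_add_left (by norm_num) L).trans eL3
  have eA1 : (L + 3) * (n + 1) ≤ X ^ (A + 3) := xpow_mul hX2 eL3 en1 (by omega)
  have eA1' : (L + 3) * (n + 1) + 2 * n ≤ X ^ (A + 4) := xpow_add hX2 eA1 e2n (by omega) (by omega)
  have eB : (L + 3) * (n + 1) + 2 * n + 5 ≤ X ^ (A + 5) := xpow_add hX2 eA1' c5 (by omega) (by omega)
  have e2Mc : 2 * Mc ≤ X ^ 2 := by
    rw [two_mul]; exact xpow_add hX2 eMc eMc (by norm_num) (by norm_num)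
  have e2Mcm : 2 * Mc + m ≤ X ^ 3 := xpow_add hX2 e2Mc em (by norm_num) (by norm_num)
  have eT2 : (2 * Mc + m) * ((L + 3) * (n + 1) + 2 * n + 5) ≤ X ^ (A + 8) :=
    xpow_mul hX2 e2Mcm eB (by omega)
  have eT3a : (L + 2) * (n + 1) ≤ X ^ (A + 3) := xpow_mul hX2 eL2 en1 (by omega)
  have eT3b : L + (L + 2) * (n + 1) ≤ X ^ (A + 4) := xpow_add hX2 eL eT3a (by omega) (by omega)
  have eT3c : L + (L + 2) * (n + 1) + 5 ≤ X ^ (A + 5) := xpow_add hX2 eT3b c5 (by omega) (by omega)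
  have eT3 : m * (L + (L + 2) * (n + 1) + 5) ≤ X ^ (A + 6) := xpow_mul hX2 em eT3c (by omega)
  have eT4 : n * (L + 2) ≤ X ^ (A + 2) := xpow_mul hX2 en eL2 (by omega)
  have et1 : (L + 3) * (n + 1) + (2 * Mc + m) * ((L + 3) * (n + 1) + 2 * n + 5) ≤ X ^ (A + 9) :=
    xpow_add hX2 eA1 eT2 (by omega) (by omega)
  have et2 : (L + 3) * (n + 1) + (2 * Mc + m) * ((L + 3) * (n + 1) + 2 * n + 5) +
      m * (L + (L + 2) * (n + 1) + 5) ≤ X ^ (A + 10) := xpow_add hX2 et1 eT3 (by omega) (by omega)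
  have et3 : (L + 3) * (n + 1) + (2 * Mc + m) * ((L + 3) * (n + 1) + 2 * n + 5) +
      m * (L + (L + 2) * (n + 1) + 5) + n * (L + 2) ≤ X ^ (A + 11) :=
    xpow_add hX2 et2 eT4 (by omega) (by omega)
  have et4 : (L + 3) * (n + 1) + (2 * Mc + m) * ((L + 3) * (n + 1) + 2 * n + 5) +
      m * (L + (L + 2) * (n + 1) + 5) + n * (L + 2) + L ≤ X ^ (A + 12) :=
    xpow_add hX2 et3 eL (by omega) (by omega)
  have et5 : (L + 3) * (n + 1) + (2 * Mc + m) * ((L + 3) * (n + 1) + 2 * n + 5) +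
      m * (L + (L + 2) * (n + 1) + 5) + n * (L + 2) + L + 5 ≤ X ^ (A + 13) :=
    xpow_add hX2 et4 c5 (by omega) (by omega)
  have et : t ≤ X ^ (A + 13) := ht.trans et5
  -- the abstract proof budget
  have e3Mc : 3 * Mc ≤ X ^ 3 := by
    rw [show 3 * Mc = 2 * Mc + Mc from by ring]
    exact xpow_add hX2 e2Mc eMc (by norm_num) (by norm_num)
  have e2hl : 2 * hl ≤ X ^ 7 := by
    rw [two_mul]; exact xpow_add hX2 ehl ehl (by norm_num) (by norm_num)
  have e3hl : 3 * hl ≤ X ^ 8 := by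
    rw [show 3 * hl = 2 * hl + hl from by ring]
    exact xpow_add hX2 e2hl ehl (by norm_num) (by norm_num)
  have et'1 : t + 3 * Mc ≤ X ^ (A + 14) := xpow_add hX2 et e3Mc (by omega) (by omega)
  have et'2 : t + 3 * Mc + 3 * hl ≤ X ^ (A + 15) := xpow_add hX2 et'1 e3hl (by omega) (by omega)
  have c4 : 4 ≤ X ^ 2 := xpow_const 2 hX2 (by norm_num)
  have et' : t + 3 * Mc + 3 * hl + 4 ≤ X ^ (A + 16) := xpow_add hX2 et'2 c4 (by omega) (by omega)
  have eW1 : Mc + hl ≤ X ^ 7 := xpow_add hX2 eMc ehl (by norm_num) (by norm_num)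
  have eW2 : Mc + hl + n ≤ X ^ 8 := xpow_add hX2 eW1 en (by norm_num) (by norm_num)
  have c6015 : 6015 ≤ X ^ 13 := xpow_const 13 hX2 (by norm_num)
  have eW : W ≤ X ^ 14 := by
    rw [hW]; exact xpow_add hX2 eW2 c6015 (by norm_num) (by norm_num)
  have eW3 : W + 3 ≤ X ^ 15 := xpow_add hX2 eW c3 (by norm_num) (by norm_num)
  have eW4 : W + 4 ≤ X ^ 15 := xpow_add hX2 eW c4 (by norm_num) (by norm_num)
  have c300 : 300 ≤ X ^ 9 := xpow_const 9 hX2 (by norm_num)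
  have c100 : 100 ≤ X ^ 7 := xpow_const 7 hX2 (by norm_num)
  have eK1 : 300 * (W + 3) ≤ X ^ 24 := xpow_mul hX2 c300 eW3 (by norm_num)
  have eK2 : 300 * (W + 3) * (W + 3) ≤ X ^ 39 := xpow_mul hX2 eK1 eW3 (by norm_num)
  have eKq : 300 * (W + 3) * (W + 3) + 100 ≤ X ^ 40 := xpow_add hX2 eK2 c100 (by norm_num) (by norm_num)
  have eP1 : (t + 3 * Mc + 3 * hl + 4) * (300 * (W + 3) * (W + 3) + 100) ≤ X ^ (A + 56) :=
    xpow_mul hX2 et' eKq (by omega)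
  have c8 : 8 ≤ X ^ 3 := xpow_const 3 hX2 (by norm_num)
  have eP : (t + 3 * Mc + 3 * hl + 4) * (300 * (W + 3) * (W + 3) + 100) + 8 ≤ X ^ (A + 57) :=
    xpow_add hX2 eP1 c8 (by omega) (by omega)
  have c25 : 25 ≤ X ^ 5 := xpow_const 5 hX2 (by norm_num)
  have eM1 : 25 * hl ≤ X ^ 11 := xpow_mul hX2 c25 ehl (by norm_num)
  have eM2 : 25 * hl + S ≤ X ^ 12 := xpow_add hX2 eM1 eS (by norm_num) (by norm_num)
  have c41 : 41 ≤ X ^ 6 := xpow_const 6 hX2 (by norm_num)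
  have eM3 : 25 * hl + S + 41 ≤ X ^ 13 := xpow_add hX2 eM2 c41 (by norm_num) (by norm_num)
  have c14 : 14 ≤ X ^ 4 := xpow_const 4 hX2 (by norm_num)
  have eM : M + 14 ≤ X ^ 14 := xpow_add hX2 (hM.trans eM3) c14 (by norm_num) (by norm_num)
  have c64 : 64 ≤ X ^ 6 := xpow_const 6 hX2 (by norm_num)
  have eΛ1 : 64 * (W + 4) ≤ X ^ 21 := xpow_mul hX2 c64 eW4 (by norm_num)
  have eΛ : 64 * (W + 4) * (M + 14) ≤ X ^ 35 := xpow_mul hX2 eΛ1 eM (by norm_num)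
  have esz : ((t + 3 * Mc + 3 * hl + 4) * (300 * (W + 3) * (W + 3) + 100) + 8) *
      (64 * (W + 4) * (M + 14)) ≤ X ^ (A + 92) := xpow_mul hX2 eP eΛ (by omega)
  -- the transferred proof
  have c6 : 6 ≤ X ^ 3 := xpow_const 3 hX2 (by norm_num)
  have e6hl : 6 * hl ≤ X ^ 9 := xpow_mul hX2 c6 ehl (by norm_num)
  have eF1a : ((t + 3 * Mc + 3 * hl + 4) * (300 * (W + 3) * (W + 3) + 100) + 8) *
      (64 * (W + 4) * (M + 14)) + 6 * hl ≤ X ^ (A + 93) := xpow_add hX2 esz e6hl (by omega) (by omega)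
  have eF1 : ((t + 3 * Mc + 3 * hl + 4) * (300 * (W + 3) * (W + 3) + 100) + 8) *
      (64 * (W + 4) * (M + 14)) + 6 * hl + 1 ≤ X ^ (A + 94) :=
    xpow_add hX2 eF1a e1 (by omega) (by omega)
  have eF2a : 2 * (((t + 3 * Mc + 3 * hl + 4) * (300 * (W + 3) * (W + 3) + 100) + 8) *
      (64 * (W + 4) * (M + 14))) ≤ X ^ (A + 93) := by
    rw [two_mul]; exact xpow_add hX2 esz esz (by omega) (by omega)
  have eF2b : 2 * (((t + 3 * Mc + 3 * hl + 4) * (300 * (W + 3) * (W + 3) + 100) + 8) *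
      (64 * (W + 4) * (M + 14))) + 1 ≤ X ^ (A + 94) := xpow_add hX2 eF2a e1 (by omega) (by omega)
  have eF2 : (2 * (((t + 3 * Mc + 3 * hl + 4) * (300 * (W + 3) * (W + 3) + 100) + 8) *
      (64 * (W + 4) * (M + 14))) + 1) * (n + 1) ≤ X ^ (A + 96) :=
    xpow_mul hX2 eF2b en1 (by omega)
  have hfin := xpow_mul hX2 eF1 eF2 (le_refl (A + 94 + (A + 96)))
  have hexp : A + 94 + (A + 96) = 12194 := by omega
  rw [hexp] at hfin
  exact hfin

end Summit.PneNP.PneNP.Theorems.ModTwo
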